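import Literature.Computability.Cryptography.RegevReduction
import Literature.Algebra.EuclideanLattices.GapCVPPrimeMachine
import HarnessLib

/-!
# Regev's quantum reduction, `GapSVP` form, II: the [GMSS99] step from the closure of `PromiseBQP` under Cook reductions

Topic `Computability/Cryptography` (family `pqc`). Sequel of `RegevReduction.lean`, the
architecture of the named fact `Literature.Computability.Cryptography.regev_lwe_to_gapSVP_quantum`
(pqc.S19; Regev, J. ACM 56 (2009), Thm 1.1 with §3.3), whose proved assembly
`regev_lwe_to_gapSVP_quantum_of_dgs (hB) (hL) (hG)` takes as third hypothesis `hG` the MACHINE FORM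
of Regev's sentence (§3.3, p. 21 of arXiv:2401.03703): *"Hence, since [GMSS99] showed that for any
`γ ≥ 1`, there is a polynomial time reduction from `GapSVP_γ` to `GapCVP'_γ` … we obtain that
under the assumptions of Theorem 3.1 there exists an efficient quantum algorithm for
`GapSVP_{O(n/α)}`"* — a quantum `GapCVP′_γ` decider (eventually in the dimension) yields a quantum
`GapSVP_γ` decider.

Everything here is PROVED; no named fact is introduced. The problem-specific half of `hG` is
already a theorem of the tree: the [GMSS99] reduction (= Micciancio–Regev 2007, Lemma 5.22) is the
explicit oracle algorithm `gmssAlg` and `gapSVP_cookReducible_gapCVP'_holds` (`GapCVPPrime.lean`,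
`GapCVPPrimeMachine.lean`: a Cook reduction of promise problems in the sense of Goldreich 2006,
Def. 3, dimension-wise, polynomial time at `TM2` level). What `hG` adds to it is GENERIC: the
closure of bounded-error quantum polynomial time under Cook reductions of promise problems —
"if `Π` is Cook-reducible to a promise problem in BQP then `Π` is in BQP" — the quantum twin of the
tree's classical `PromiseProblem.mem_PromiseBPP'_of_cookReducible` (Goldreich 2006, §1.2, remark
after Def. 3; DISCHARGED in `PromiseCookReductionsProofs.lean`), i.e. Bennett–Bernstein–Brassard–
Vazirani's `BQP^BQP = BQP` (Cor. 4.15) read for promise oracles. This file isolates exactly that: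

* `Regev2009.exists_restrict_mem_PromiseBQP_of_eventually`,
  `Regev2009.exists_eventually_of_restrict_mem_PromiseBQP` — the dictionary between the
  "uniform quantum family deciding every instance of large dimension" clauses of pqc.S19 / `hL` /
  `hG` (`UniformQCircuitFamily`, thresholds `2/3`–`1/3`, `∀ᶠ n`) and membership in `PromiseBQP`
  (`ClassBQP.lean`) of the promise problem restricted to dimensions `≥ n₀`
  (`PromiseProblem.ofEncoding … {p | p ∈ YES ∧ dim p ∈ Set.Ici n₀} …`, the shape used by
  `gapSVP_cookReducible_gapCVP'`);
* **`gmss_gapSVP_of_gapCVP'_quantum_of_cookClosure`** — `hG` for EVERY factor `γ` from the single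
  generic hypothesis
  `hC : ∀ Q₁ Q₂, Q₁.CookReducible Q₂ → Q₂ ∈ PromiseBQP → Q₁ ∈ PromiseBQP`
  (proof: restrict to dimensions `≥ n₀`, apply `hC` to `gapSVP_cookReducible_gapCVP'_holds γ (Ici n₀)`,
  unrestrict);
* **`regev_lwe_to_gapSVP_quantum_of_dgs_cook (hB) (hL) (hC)`** and
  **`regev_lwe_to_gapSVP_quantum_of_worstCase_cook (h₁) (h₂) (hL) (hC)`** — the assemblies of
  `RegevReduction.lean` with `hG` replaced by `hC`.

So, after this file, the GapSVP form of pqc.S19 rests on: Thm 3.1 (`hB`, or `h₁` + `h₂`, shared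
verbatim with the SIVP form), Lemma 3.20 in machine form (`hL`; its mathematics is in
`Algebra/EuclideanLattices/ARVerifierRandomWitness.lean`), and the generic quantum Cook closure `hC`.

## On the hypothesis `hC` (not proved here; no statement of the tree asserts it)

Printed sources: Bennett–Bernstein–Brassard–Vazirani 1997, Thm. 4.14 (a BQP machine with success
amplified to `1 - ε` can be made *tidy* — run, copy the answer, undo — and then used as a
subroutine by a quantum machine, the final superposition deviating by `O(√ε)` per call) and
Cor. 4.15 (`BQP^BQP = BQP`); Bernstein–Vazirani 1997, §8 (oracle machines); Watrous 2009, §IV.4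
(the subroutine theorem for circuits); for PROMISE problems as oracles, Goldreich 2006, §1.2
(Def. 3 and the remark after it): the reduction must be correct for EVERY oracle consistent with
the promise, and a bounded-error decider for `Q₂` is turned into such an oracle by error reduction
plus memoisation of repeated queries. In the tree's model all ingredients of that proof are present
as theorems — `exists_poly_amplified` (`PolyMajority.lean`, inverse-polynomial error),
`uniformOracleCoinSimulation_holds` (`CoinFamilyKernelProofs.lean`, coins and the reversible
simulation of a polynomial-time oracle algorithm with oracle gates), `TidyBlock.lean` /
`OracleSubstitution.lean` / `BQPSubroutine.lean` (tidy blocks, substitution for oracle gates and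
its error bound, uniformity of the substituted family; assembled for LANGUAGE oracles as
`isQSolvable_of_mem_BQP_oracle_holds`), and the memoising wrapper of `PromiseCookMachine.lean`
(classical twin) — but their assembly for promise oracles (error bound needed only along the
on-promise queries of each consistent deterministic oracle) is not in the tree; it is the one
generic infrastructure statement on which `hG` depends, and it is recorded here as a hypothesis,
not vendored as a fact (D-0026).

## References

* O. Regev, *On lattices, learning with errors, random linear codes, and cryptography*, J. ACM 56
  (2009), art. 34 (arXiv:2401.03703), §3.3 (p. 21: the [GMSS99] sentence), Thm 1.1 [Regev2009].
* O. Goldreich, D. Micciancio, S. Safra, J.-P. Seifert, *Approximating shortest lattice vectors is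
  not harder than approximating closest lattice vectors*, IPL 71 (1999), §3, Thm. 1
  [GoldreichMicciancioSafraSeifert1999].
* D. Micciancio, O. Regev, *Worst-case to average-case reductions based on Gaussian measures*,
  SIAM J. Comput. 37 (2007), Def. 5.21, Lemma 5.22 [MicciancioRegev2007].
* O. Goldreich, *On promise problems: a survey*, LNCS 3895 (2006) 254–290, §1.2, Def. 3 and the
  remark after it (p. 258) [Goldreich2006].
* C. H. Bennett, E. Bernstein, G. Brassard, U. Vazirani, *Strengths and weaknesses of quantum
  computing*, SIAM J. Comput. 26 (1997) 1510–1523, Thm. 4.14, Cor. 4.15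
  [BennettBernsteinBrassardVazirani1997].
* J. Watrous, *Quantum computational complexity*, Encyclopedia of Complexity and Systems Science
  (2009) = arXiv:0804.3401, §IV.4 [Watrous2009].
-/

noncomputable section

open Filter Literature.Computability.Complexity Literature.Computability.Cryptography.LWE
  Literature.Algebra.EuclideanLattices
open scoped ENNReal Topology

namespace Literature.Computability.Cryptography

namespace Regev2009

/-! ### Eventual deciders versus `PromiseBQP` membership of the dimension-restricted problem -/

/-- **From an eventual decider to `PromiseBQP`** (`GapCVP′` version, the shape of the conclusion of
`hL` and of the hypothesis of `hG`): if a uniform quantum family accepts YES instances of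
`GapCVP′_γ` with probability `≥ 2/3` and NO instances with probability `≤ 1/3` in every large
dimension, then for some `n₀` the promise problem "`GapCVP′_γ` restricted to dimensions `≥ n₀`"
(codes under `gapCVPInstanceEncoding`) is in `PromiseBQP`. [cite: Watrous2009, §III.2 (PromiseBQP); Goldreich2006 §1.3 (restrictions of promise problems)] -/
theorem exists_restrict_mem_PromiseBQP_of_eventually {γ : ℕ → ℝ}
    (h : ∃ Q : UniformQCircuitFamily, ∀ᶠ n : ℕ in atTop, ∀ p : GapCVPInstance, p.1.I.n = n →
      (p ∈ GapCVP'.yes γ → 2 / 3 ≤ Q.acceptProb p.encode) ∧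
      (p ∈ GapCVP'.no γ → Q.acceptProb p.encode ≤ 1 / 3)) :
    ∃ n₀ : ℕ, PromiseProblem.ofEncoding gapCVPInstanceEncoding
        {p | p ∈ GapCVP'.yes γ ∧ p.1.I.n ∈ Set.Ici n₀} {p | p ∈ GapCVP'.no γ ∧ p.1.I.n ∈ Set.Ici n₀} ∈
      PromiseBQP := by
  obtain ⟨Q, hQ⟩ := h
  obtain ⟨n₀, hn₀⟩ := eventually_atTop.1 hQ
  refine ⟨n₀, UniformQCircuitFamily.mem_promiseBQP _ Q ?_ ?_⟩
  · rintro x ⟨p, ⟨hp, hpn⟩, rfl⟩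
    exact ((hn₀ p.1.I.n hpn p rfl).1 hp)
  · rintro x ⟨p, ⟨hp, hpn⟩, rfl⟩
    exact ((hn₀ p.1.I.n hpn p rfl).2 hp)

/-- **From `PromiseBQP` to an eventual decider** (`GapSVP` version, the shape of the conclusion of
`hG` and of pqc.S19): if "`GapSVP_γ` restricted to dimensions `≥ n₀`" (codes under
`gapSVPInstanceEncoding`) is in `PromiseBQP`, its witnessing family, bundled as a
`UniformQCircuitFamily`, accepts YES instances with probability `≥ 2/3` and NO instances with
probability `≤ 1/3` in every dimension `n ≥ n₀`, hence eventually.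
[cite: Watrous2009, §III.2 (PromiseBQP); Goldreich2006 §1.3 (restrictions of promise problems)] -/
theorem exists_eventually_of_restrict_mem_PromiseBQP {γ : ℕ → ℝ} {n₀ : ℕ}
    (h : PromiseProblem.ofEncoding gapSVPInstanceEncoding
        {p | p ∈ GapSVP.yes γ ∧ p.1.n ∈ Set.Ici n₀} {p | p ∈ GapSVP.no γ ∧ p.1.n ∈ Set.Ici n₀} ∈
      PromiseBQP) :
    ∃ Q : UniformQCircuitFamily, ∀ᶠ n : ℕ in atTop, ∀ p : GapSVPInstance, p.1.n = n →
      (p ∈ GapSVP.yes γ → 2 / 3 ≤ Q.acceptProb p.encode) ∧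
      (p ∈ GapSVP.no γ → Q.acceptProb p.encode ≤ 1 / 3) := by
  obtain ⟨F, hfree, hunif, hyes, hno⟩ := h
  refine ⟨⟨F, hfree, hunif⟩, ?_⟩
  filter_upwards [eventually_ge_atTop n₀] with n hn p hpn
  refine ⟨fun hp => hyes _ ⟨p, ⟨hp, ?_⟩, rfl⟩, fun hp => hno _ ⟨p, ⟨hp, ?_⟩, rfl⟩⟩
  · simpa [hpn] using hn
  · simpa [hpn] using hn

/-! ### `hG` from the closure of `PromiseBQP` under Cook reductions -/

/-- **The [GMSS99] step of Regev's §3.3 at machine level, from the generic closure of `PromiseBQP`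
under Cook reductions of promise problems.** For EVERY factor `γ` (no `γ ≥ 1` needed): if some
uniform quantum family decides `GapCVP′_γ` in every large dimension, then some uniform quantum
family decides `GapSVP_γ` in every large dimension — provided
`hC : ∀ Q₁ Q₂, Q₁.CookReducible Q₂ → Q₂ ∈ PromiseBQP → Q₁ ∈ PromiseBQP` (Bennett–Bernstein–
Brassard–Vazirani 1997, Cor. 4.15 `BQP^BQP = BQP`, for promise oracles in the sense of Goldreich
2006, §1.2; the quantum twin of the tree theorem `PromiseProblem.mem_PromiseBPP'_of_cookReducible_holds`).
Proof: restrict `GapCVP′_γ` to the dimensions `≥ n₀` where the decider is good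
(`exists_restrict_mem_PromiseBQP_of_eventually`); the GMSS reduction is a dimension-preserving
Cook reduction of promise problems, `gapSVP_cookReducible_gapCVP'_holds γ (Set.Ici n₀)` (MR07
Lemma 5.22 with the `TM2` running time of `gmssAlg`, both theorems of the tree); apply `hC` and
unbundle (`exists_eventually_of_restrict_mem_PromiseBQP`).
[cite: Regev2009, §3.3 (p. 21, the GMSS99 sentence); MicciancioRegev2007 Lemma 5.22; BennettBernsteinBrassardVazirani1997 Cor. 4.15; Goldreich2006 §1.2 Def. 3 and remark] -/
theorem gmss_gapSVP_of_gapCVP'_quantum_of_cookClosure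
    (hC : ∀ Q₁ Q₂ : PromiseProblem, Q₁.CookReducible Q₂ → Q₂ ∈ PromiseBQP → Q₁ ∈ PromiseBQP)
    (γ : ℕ → ℝ)
    (h : ∃ Q : UniformQCircuitFamily, ∀ᶠ n : ℕ in atTop, ∀ p : GapCVPInstance, p.1.I.n = n →
      (p ∈ GapCVP'.yes γ → 2 / 3 ≤ Q.acceptProb p.encode) ∧
      (p ∈ GapCVP'.no γ → Q.acceptProb p.encode ≤ 1 / 3)) :
    ∃ Q : UniformQCircuitFamily, ∀ᶠ n : ℕ in atTop, ∀ p : GapSVPInstance, p.1.n = n →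
      (p ∈ GapSVP.yes γ → 2 / 3 ≤ Q.acceptProb p.encode) ∧
      (p ∈ GapSVP.no γ → Q.acceptProb p.encode ≤ 1 / 3) := by
  obtain ⟨n₀, hn₀⟩ := exists_restrict_mem_PromiseBQP_of_eventually h
  exact exists_eventually_of_restrict_mem_PromiseBQP
    (hC _ _ (gapSVP_cookReducible_gapCVP'_holds γ (Set.Ici n₀)) hn₀)

end Regev2009

/-! ### Assembly: pqc.S19 (GapSVP form) from Thm 3.1, Lemma 3.20 and the quantum Cook closure -/

section Assembly

variable (q : ℕ → ℕ) [∀ n, NeZero (q n)] (α : ℕ → ℝ) (m : ℕ → ℕ)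

/-- **Assembly of pqc.S19 (GapSVP form) with the [GMSS99] step supplied by the tree's GMSS Cook
reduction and the generic closure of `PromiseBQP` under Cook reductions.** Hypotheses `hB`
(Regev's Thm 3.1, machine form) and `hL` (Lemma 3.20, machine form) are VERBATIM those of
`regev_lwe_to_gapSVP_quantum_of_dgs` (see the docstring there); its third hypothesis `hG` is
replaced by
`hC : ∀ Q₁ Q₂, Q₁.CookReducible Q₂ → Q₂ ∈ PromiseBQP → Q₁ ∈ PromiseBQP`
(Bennett–Bernstein–Brassard–Vazirani 1997, Cor. 4.15, for promise oracles; Goldreich 2006, §1.2),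
through `Regev2009.gmss_gapSVP_of_gapCVP'_quantum_of_cookClosure`.
[cite: Regev2009, Thm 1.1 and §3.3 (Lemma 3.20 with GMSS99); BennettBernsteinBrassardVazirani1997 Cor. 4.15] -/
theorem regev_lwe_to_gapSVP_quantum_of_dgs_cook
    (hB : ∀ (_ : IsPolyBounded m) (_ : IsPolyTimeParams q α m)
      (_ : ∀ᶠ n : ℕ in atTop, 0 < α n ∧ α n < 1 ∧ 2 * Real.sqrt n < α n * q n)
      (_ : ∃ Q : UniformQCircuitFamily, SearchLWESolves q (fun n => discretizedGaussian (q n) (α n))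
        m (fun n => Q.searchLWESolver n (q n) (m n)) fun _ => 2 / 3)
      (ε : ℕ → ℝ), IsNegligible ε → (∀ n, 0 < ε n) →
      ∃ (D : UniformQCircuitFamily) (ν : ℕ → ℝ), IsNegligible ν ∧ D.SamplesDGS (regevDGSBound α ε) ν)
    (hL : ∀ (γ : ℕ → ℝ), (∀ n, 1 ≤ γ n) →
      (∃ (D : UniformQCircuitFamily) (ν : ℕ → ℝ),
          IsNegligible ν ∧ D.SamplesDGS (Regev2009.dgsBoundDual γ) ν) →
      ∃ Q : UniformQCircuitFamily, ∀ᶠ n : ℕ in atTop, ∀ p : GapCVPInstance, p.1.I.n = n →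
        (p ∈ GapCVP'.yes (fun k => 100 * Real.sqrt k * γ k) → 2 / 3 ≤ Q.acceptProb p.encode) ∧
        (p ∈ GapCVP'.no (fun k => 100 * Real.sqrt k * γ k) → Q.acceptProb p.encode ≤ 1 / 3))
    (hC : ∀ Q₁ Q₂ : PromiseProblem, Q₁.CookReducible Q₂ → Q₂ ∈ PromiseBQP → Q₁ ∈ PromiseBQP) :
    regev_lwe_to_gapSVP_quantum q α m :=
  regev_lwe_to_gapSVP_quantum_of_dgs q α m hB hL
    fun γ _ h => Regev2009.gmss_gapSVP_of_gapCVP'_quantum_of_cookClosure hC γ h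

/-- **The same with Thm 3.1 in Regev's worst-case form**: hypotheses `h₁` (average-case bridge)
and `h₂` (Thm 3.1 as printed) VERBATIM those of `regev_lwe_to_gapSVP_quantum_of_worstCase` (and of
the SIVP form `regev_lwe_to_sivp_quantum_of_worstCase`), `hL` as above, and the generic quantum
Cook closure `hC` in place of `hG`.
[cite: Regev2009, Thm 3.1 (with §2 p. 12, Lemmas 3.6, 4.1, 4.3), Lemma 3.20 and §3.3; BennettBernsteinBrassardVazirani1997 Cor. 4.15] -/
theorem regev_lwe_to_gapSVP_quantum_of_worstCase_cook
    (h₁ : ∀ (_ : IsPolyBounded m) (_ : IsPolyTimeParams q α m)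
      (_ : ∀ᶠ n : ℕ in atTop, 0 < α n ∧ α n < 1 ∧ 2 * Real.sqrt n < α n * q n)
      (_ : ∃ Q : UniformQCircuitFamily, SearchLWESolves q (fun n => discretizedGaussian (q n) (α n))
        m (fun n => Q.searchLWESolver n (q n) (m n)) fun _ => 2 / 3),
      ∃ (W : UniformQCircuitFamily) (m' : ℕ → ℕ) (c : ℝ), IsPolyBounded m' ∧
        IsPolyTimeParams q α m' ∧ 0 < c ∧
        W.SolvesSearchLWEWorstCase q (fun n => discretizedGaussian (q n) (α n)) m'
          fun n => (2 : ℝ) ^ (-(c * n)))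
    (h₂ : ∀ (m' : ℕ → ℕ) (_ : IsPolyBounded m') (_ : IsPolyTimeParams q α m')
      (_ : ∀ᶠ n : ℕ in atTop, 0 < α n ∧ α n < 1 ∧ 2 * Real.sqrt n < α n * q n)
      (_ : ∃ (W : UniformQCircuitFamily) (c : ℝ), 0 < c ∧
        W.SolvesSearchLWEWorstCase q (fun n => discretizedGaussian (q n) (α n)) m'
          fun n => (2 : ℝ) ^ (-(c * n)))
      (ε : ℕ → ℝ), IsNegligible ε → (∀ n, 0 < ε n) →
      ∃ (D : UniformQCircuitFamily) (ν : ℕ → ℝ), IsNegligible ν ∧ D.SamplesDGS (regevDGSBound α ε) ν)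
    (hL : ∀ (γ : ℕ → ℝ), (∀ n, 1 ≤ γ n) →
      (∃ (D : UniformQCircuitFamily) (ν : ℕ → ℝ),
          IsNegligible ν ∧ D.SamplesDGS (Regev2009.dgsBoundDual γ) ν) →
      ∃ Q : UniformQCircuitFamily, ∀ᶠ n : ℕ in atTop, ∀ p : GapCVPInstance, p.1.I.n = n →
        (p ∈ GapCVP'.yes (fun k => 100 * Real.sqrt k * γ k) → 2 / 3 ≤ Q.acceptProb p.encode) ∧
        (p ∈ GapCVP'.no (fun k => 100 * Real.sqrt k * γ k) → Q.acceptProb p.encode ≤ 1 / 3))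
    (hC : ∀ Q₁ Q₂ : PromiseProblem, Q₁.CookReducible Q₂ → Q₂ ∈ PromiseBQP → Q₁ ∈ PromiseBQP) :
    regev_lwe_to_gapSVP_quantum q α m :=
  regev_lwe_to_gapSVP_quantum_of_worstCase q α m h₁ h₂ hL
    fun γ _ h => Regev2009.gmss_gapSVP_of_gapCVP'_quantum_of_cookClosure hC γ h

end Assembly

end Literature.Computability.Cryptography

end
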